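import Summits.Parity.BatemanHorn.Theorems.SelbergDelangeRigidityLSDRealSegmentTailsLinearAux
import Literature.NumberTheory.LFunctions.MertensSecondLogPower
import HarnessLib

/-!
# Route `SelbergDelangeRigidity`, crux `LSDRealSegment` (stmt-Parity-9770), line
# `product-anatomy-subcritical`: tails for ONE LINEAR FORM and for the EMPTY SYSTEM (cases of `stub_tails`)

`topClassBound_linear`: for `f₀ = aX + b` (`a ≥ 1`) and `1 ≤ y < 2`, the `n ≤ x` whose value `an + b` has a prime
factor `p > x^{1−η}` carry tilted mass `Σ y^{Ω(an+b)} ≤ ε x (log x)^{y−1}` for `η = η(ε)`: writing `an + b = p r`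
and grouping by `p`, the mass is `≤ y Σ_{x^{1−η} < p ≤ (a+|b|)x} Σ_{r ≤ M/p} y^{Ω(r)} ≤ y C M (log M)^{y−1} Σ_p 1/p`
(order of magnitude `tails_smoothTilt_sum_le` at `σ = 0`) and `Σ_{x^{1−η} < p ≤ (a+|b|) x} 1/p ≤ 3η` eventually by
Mertens' second theorem on both ends (`Literature.NumberTheory.LFunctions.Mertens.abs_sum_primesLE_inv_sub_loglog_le`,
PROVED).  With `tails_linear_three` this gives ALL FOUR clauses of `stub_tails` for one linear form
(`tails_linear_single`, registered), and the empty system `k = 0` is trivial (`tails_empty`, registered): both are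
genuine unconditional cases of `stub_tails`.
-/

open Filter Finset Polynomial
open scoped BigOperators Topology Classical

namespace Summit.Parity.BatemanHorn.Cruxes.LSDRealSegment.ProductAnatomySubcritical

open Literature.NumberTheory.Sieve
open ArithmeticFunction (cardFactors)
noncomputable section

/-! ### Two counting tools -/

/-- The multiples of `p ≥ 1` in `[1, M]` are the `p r`, `1 ≤ r ≤ M/p`. [folklore] -/
theorem sum_filter_dvd_eq {p : ℕ} (hp : 0 < p) (M : ℕ) (h : ℕ → ℝ) :
    ∑ m ∈ (Icc 1 M).filter (fun m => p ∣ m), h m = ∑ r ∈ Icc 1 (M / p), h (p * r) := by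
  have himg : (Icc 1 M).filter (fun m => p ∣ m) = (Icc 1 (M / p)).image (fun r => p * r) := by
    ext m
    simp only [Finset.mem_filter, Finset.mem_Icc, Finset.mem_image]
    constructor
    · rintro ⟨⟨h1, h2⟩, r, rfl⟩
      refine ⟨r, ⟨?_, ?_⟩, rfl⟩
      · rcases Nat.eq_zero_or_pos r with rfl | hr
        · simp at h1
        · exact hr
      · exact (Nat.le_div_iff_mul_le hp).mpr (by rw [mul_comm]; exact h2)
    · rintro ⟨r, ⟨h1, h2⟩, rfl⟩
      refine ⟨⟨Nat.one_le_iff_ne_zero.mpr (Nat.mul_ne_zero hp.ne' (by omega)), ?_⟩, dvd_mul_right p r⟩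
      calc p * r ≤ p * (M / p) := Nat.mul_le_mul_left p h2
        _ ≤ M := Nat.mul_div_le M p
  rw [himg, Finset.sum_image fun r _ r' _ h => mul_left_cancel₀ hp.ne' h]

/-- **The prime window** (Mertens' second theorem at both ends): for `2 ≤ W ≤ N`,
`Σ_{W < p ≤ N} 1/p ≤ log(log N / log W) + 2K/log W`. [folklore] -/
theorem sum_inv_primes_window_le : ∃ K : ℝ, 0 ≤ K ∧ ∀ (W : ℝ) (N : ℕ), 2 ≤ W → W ≤ N →
    ∑ p ∈ (Nat.primesLE N).filter (fun p : ℕ => W < (p : ℝ)), (1 : ℝ) / p ≤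
      Real.log (Real.log N / Real.log W) + 2 * K / Real.log W := by
  obtain ⟨K, hK⟩ := Literature.NumberTheory.LFunctions.Mertens.abs_sum_primesLE_inv_sub_loglog_le 1
  have hK0 : 0 ≤ K := by
    have h := (abs_nonneg _).trans (hK 2 le_rfl)
    rw [pow_one] at h
    have hl2 : 0 < Real.log 2 := Real.log_pos one_lt_two
    by_contra hneg
    have : K / Real.log 2 < 0 := div_neg_of_neg_of_pos (not_le.mp hneg) hl2
    linarith
  refine ⟨K, hK0, fun W N hW hWN => ?_⟩
  have hW0 : 0 ≤ W := by linarith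
  have hN2 : (2 : ℝ) ≤ N := hW.trans hWN
  have hlogW : 0 < Real.log W := Real.log_pos (by linarith)
  have hlogN : Real.log W ≤ Real.log N := Real.log_le_log (by linarith) hWN
  have hset : (Nat.primesLE N).filter (fun p : ℕ => W < (p : ℝ)) = Nat.primesLE N \ Nat.primesLE ⌊W⌋₊ := by
    ext p
    simp only [Finset.mem_filter, Finset.mem_sdiff, Nat.mem_primesLE, not_and]
    constructor
    · rintro ⟨⟨h1, h2⟩, h3⟩
      refine ⟨⟨h1, h2⟩, fun h _ => ?_⟩
      have : (p : ℝ) ≤ W := (Nat.cast_le.mpr h).trans (Nat.floor_le hW0)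
      linarith
    · rintro ⟨⟨h1, h2⟩, h3⟩
      refine ⟨⟨h1, h2⟩, ?_⟩
      have : ¬p ≤ ⌊W⌋₊ := fun h => h3 h h2
      exact (Nat.floor_lt hW0).mp (not_le.mp this)
  have hsub : Nat.primesLE ⌊W⌋₊ ⊆ Nat.primesLE N := by
    intro p hp
    rw [Nat.mem_primesLE] at hp ⊢
    exact ⟨hp.1.trans (Nat.floor_le_of_le hWN), hp.2⟩
  rw [hset, Finset.sum_sdiff_eq_sub hsub]
  have h1 := hK N hN2
  have h2 := hK W hW
  rw [Nat.floor_natCast, pow_one] at h1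
  rw [pow_one] at h2
  have e1 : ∑ p ∈ Nat.primesLE N, (1 : ℝ) / p = ∑ p ∈ Nat.primesLE N, (p : ℝ)⁻¹ :=
    Finset.sum_congr rfl fun p _ => one_div _
  have e2 : ∑ p ∈ Nat.primesLE ⌊W⌋₊, (1 : ℝ) / p = ∑ p ∈ Nat.primesLE ⌊W⌋₊, (p : ℝ)⁻¹ :=
    Finset.sum_congr rfl fun p _ => one_div _
  rw [e1, e2]
  have h1' := (abs_le.mp h1).2
  have h2' := (abs_le.mp h2).1
  have hKN : K / Real.log N ≤ K / Real.log W := div_le_div_of_nonneg_left hK0 hlogW hlogN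
  have hlog : Real.log (Real.log N) - Real.log (Real.log W) = Real.log (Real.log N / Real.log W) :=
    (Real.log_div (by linarith) hlogW.ne').symm
  have : 2 * K / Real.log W = K / Real.log W + K / Real.log W := by ring
  linarith

section Linear

variable {f : Fin 1 → ℤ[X]} {a b : ℤ}

/-- **TopClassBound for one linear form**: the `n ≤ x` with a prime `p > x^{1−η}` dividing `an + b` have tilted
mass `≤ ε x (log x)^{y−1}` for `η = min(1/2, ε/D)` (group by `p`, order of magnitude in `r = (an+b)/p`,
prime window `Σ 1/p ≤ 3η`). [folklore] -/
theorem topClassBound_linear (ha : 0 < a) (heval : ∀ n : ℕ, (f 0).eval (n : ℤ) = a * n + b)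
    (h1 : (f 0).natDegree = 1) {y : ℝ} (hy : 1 ≤ y) (hy2 : y < 2) : TopClassBound 1 f y := by
  intro ε hε
  obtain ⟨C, σ₀, hσ₀, hC⟩ := tails_smoothTilt_sum_le y hy hy2
  set C₁ : ℝ := max C 2 with hC₁
  have hC₁0 : 0 ≤ C₁ := le_trans (by norm_num) (le_max_right _ _)
  -- order of magnitude of `Σ_{r ≤ N} y^{Ω(r)}` for `1 ≤ N ≤ M`, against `(log M)^{y-1}`
  have hA : ∀ M N : ℕ, 2 ≤ M → 1 ≤ N → N ≤ M →
      ∑ r ∈ Icc 1 N, y ^ cardFactors r ≤ C₁ * ((N : ℝ) * Real.log M ^ (y - 1)) := by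
    intro M N hM hN1 hNM
    have hM' : (2 : ℝ) ≤ M := by exact_mod_cast hM
    have hlogM : 0 ≤ Real.log M := Real.log_natCast_nonneg M
    rcases lt_or_ge N 2 with hN2 | hN2
    · obtain rfl : N = 1 := by omega
      rw [Finset.Icc_self, Finset.sum_singleton, ArithmeticFunction.cardFactors_one, pow_zero, Nat.cast_one,
        one_mul]
      have := one_le_two_mul_log_rpow hM' (show 0 ≤ y - 1 by linarith) (by linarith)
      nlinarith [Real.rpow_nonneg hlogM (y - 1), le_max_right C 2]
    · have h := hC 2 0 N le_rfl le_rfl hσ₀.le (by simp) hN2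
      simp only [Real.rpow_zero, mul_one] at h
      have hN0 : (0 : ℝ) < N := by exact_mod_cast (show 0 < N by omega)
      have hlogN : Real.log N ≤ Real.log M := Real.log_le_log hN0 (by exact_mod_cast hNM)
      have hlogN0 : 0 ≤ Real.log N := Real.log_natCast_nonneg N
      calc ∑ r ∈ Icc 1 N, y ^ cardFactors r ≤ C * ((N : ℝ) * Real.log N ^ (y - 1)) := h
        _ ≤ C₁ * ((N : ℝ) * Real.log N ^ (y - 1)) :=
            mul_le_mul_of_nonneg_right (le_max_left _ _) (by positivity)
        _ ≤ C₁ * ((N : ℝ) * Real.log M ^ (y - 1)) :=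
            mul_le_mul_of_nonneg_left (mul_le_mul_of_nonneg_left
              (Real.rpow_le_rpow hlogN0 hlogN (by linarith)) hN0.le) hC₁0
  set L : ℕ := a.toNat + b.natAbs with hL
  have hL1 : 1 ≤ L := by omega
  obtain ⟨c, hc0, hc⟩ := exists_mul_log_rpow_le L (show 0 ≤ y - 1 by linarith)
  obtain ⟨K, hK0, hK⟩ := sum_inv_primes_window_le
  set D : ℝ := 3 * y * C₁ * c + 1 with hD
  have hD0 : 0 < D := by positivity
  set η : ℝ := min (1 / 2) (ε / D) with hη
  have hη0 : 0 < η := lt_min (by norm_num) (by positivity)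
  have hη2 : η ≤ 1 / 2 := min_le_left _ _
  have hηD : D * η ≤ ε := by
    calc D * η ≤ D * (ε / D) := mul_le_mul_of_nonneg_left (min_le_right _ _) hD0.le
      _ = ε := mul_div_cancel₀ _ hD0.ne'
  refine ⟨η, hη0, ?_⟩
  have ev1 : ∀ᶠ x : ℕ in atTop, (2 : ℝ) ≤ (x : ℝ) ^ (1 - η) :=
    ((tendsto_rpow_atTop (by linarith)).comp tendsto_natCast_atTop_atTop).eventually_ge_atTop 2
  have ev2 : ∀ᶠ x : ℕ in atTop, (2 * Real.log L + 4 * K) / η ≤ Real.log x :=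
    (Real.tendsto_log_atTop.comp tendsto_natCast_atTop_atTop).eventually_ge_atTop _
  filter_upwards [ev1, ev2, eventually_ge_atTop (2 + b.natAbs)] with x hW2 hlogx hx3
  have hx2 : 2 ≤ x := by omega
  have hxr : (2 : ℝ) ≤ x := by exact_mod_cast hx2
  have hxpos : (0 : ℝ) < x := by linarith
  have hlogx0 : 0 < Real.log x := Real.log_pos (by linarith)
  set W : ℝ := (x : ℝ) ^ (1 - η) with hWdef
  set M : ℕ := (a * x + b).toNat with hMdef
  have hM2 : 2 ≤ M := by
    have : (x : ℤ) ≤ a * x := le_mul_of_one_le_left (by positivity) (by omega)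
    omega
  have hM2' : (2 : ℝ) ≤ M := by exact_mod_cast hM2
  have hML : M ≤ L * x := toNat_le_mul ha (by omega)
  have hWx : W ≤ x := by
    calc W = (x : ℝ) ^ (1 - η) := rfl
      _ ≤ (x : ℝ) ^ (1 : ℝ) := Real.rpow_le_rpow_of_exponent_le (by linarith) (by linarith)
      _ = x := Real.rpow_one _
  have hWN : W ≤ ((L * x : ℕ) : ℝ) := hWx.trans (by exact_mod_cast Nat.le_mul_of_pos_left x hL1)
  -- Step 1: the class lives on `an + b ≥ 1`, where the weight is `g(an + b)`
  set g : ℕ → ℝ := fun m => if ∃ p ∈ m.primeFactors, W < (p : ℝ) then y ^ cardFactors m else 0 with hg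
  have hg0 : ∀ m, 0 ≤ g m := fun m => by
    simp only [hg]
    split_ifs <;> positivity
  have hcls : ∀ n ∈ (Icc 1 x).filter (fun n : ℕ => ∃ i, ∃ p ∈ (val f i n).primeFactors,
      (x : ℝ) ^ (((f i).natDegree : ℝ) - η) < (p : ℝ)), 1 ≤ a * n + b ∧ y ^ stat f n = g (a * n + b).toNat := by
    intro n hn
    obtain ⟨i, p, hp, hxp⟩ := (Finset.mem_filter.mp hn).2
    obtain rfl : i = 0 := Subsingleton.elim i 0
    rw [val, heval] at hp
    rw [h1, Nat.cast_one] at hxp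
    rcases lt_or_ge (a * n + b) 1 with hneg | hpos
    · exfalso
      rw [show (a * n + b).toNat = 0 by omega, max_eq_right zero_le_one, Nat.primeFactors_one] at hp
      simp at hp
    · refine ⟨hpos, ?_⟩
      rw [max_eq_left (by omega : 1 ≤ (a * n + b).toNat)] at hp
      rw [stat_fin_one, heval, hg]
      simp only
      rw [if_pos ⟨p, hp, hxp⟩]
  -- Step 2: `g(m) ≤ Σ_{p ∈ P} [p ∣ m] y^{Ω(m)}`, `P` the primes of `(W, M]`
  set P : Finset ℕ := (Icc 1 M).filter (fun p => p.Prime ∧ W < (p : ℝ)) with hP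
  have hstep2 : ∀ m ∈ Icc 1 M, g m ≤ ∑ p ∈ P, if p ∣ m then y ^ cardFactors m else 0 := by
    intro m hm
    simp only [hg]
    split_ifs with hcond
    · obtain ⟨p, hp, hWp⟩ := hcond
      have hp' := Nat.prime_of_mem_primeFactors hp
      have hpP : p ∈ P := by
        rw [hP, Finset.mem_filter, Finset.mem_Icc]
        exact ⟨⟨hp'.one_lt.le, (Nat.le_of_mem_primeFactors hp).trans (Finset.mem_Icc.mp hm).2⟩, hp', hWp⟩
      calc y ^ cardFactors m = (if p ∣ m then y ^ cardFactors m else 0) := by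
            rw [if_pos (Nat.dvd_of_mem_primeFactors hp)]
        _ ≤ ∑ p ∈ P, if p ∣ m then y ^ cardFactors m else 0 :=
            Finset.single_le_sum (f := fun p => if p ∣ m then y ^ cardFactors m else 0)
              (fun q _ => by positivity) hpP
    · exact Finset.sum_nonneg fun q _ => by positivity
  -- Steps 3–4: swap, and evaluate the inner sums over the multiples of `p`
  have hinner : ∀ p ∈ P, ∑ m ∈ Icc 1 M, (if p ∣ m then y ^ cardFactors m else 0) ≤
      y * C₁ * ((M : ℝ) / p * Real.log M ^ (y - 1)) := by
    intro p hp
    rw [hP, Finset.mem_filter, Finset.mem_Icc] at hp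
    obtain ⟨⟨-, hpM⟩, hp', -⟩ := hp
    rw [← Finset.sum_filter, sum_filter_dvd_eq hp'.pos]
    rw [Finset.sum_congr rfl fun r hr => by
      rw [ArithmeticFunction.cardFactors_mul hp'.ne_zero (by have := (Finset.mem_Icc.mp hr).1; omega),
        ArithmeticFunction.cardFactors_apply_prime hp', pow_add, pow_one]]
    rw [← Finset.mul_sum]
    have hNp : 1 ≤ M / p := (Nat.le_div_iff_mul_le hp'.pos).mpr (by simpa using hpM)
    have hA' := hA M (M / p) hM2 hNp (Nat.div_le_self M p)
    have hcast : ((M / p : ℕ) : ℝ) ≤ (M : ℝ) / p := Nat.cast_div_le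
    have hlogM : 0 ≤ Real.log M ^ (y - 1) := Real.rpow_nonneg (Real.log_natCast_nonneg M) _
    calc y * ∑ r ∈ Icc 1 (M / p), y ^ cardFactors r ≤ y * (C₁ * (((M / p : ℕ) : ℝ) * Real.log M ^ (y - 1))) :=
          mul_le_mul_of_nonneg_left hA' (by linarith)
      _ ≤ y * (C₁ * ((M : ℝ) / p * Real.log M ^ (y - 1))) :=
          mul_le_mul_of_nonneg_left (mul_le_mul_of_nonneg_left (mul_le_mul_of_nonneg_right hcast hlogM) hC₁0)
            (by linarith)
      _ = y * C₁ * ((M : ℝ) / p * Real.log M ^ (y - 1)) := by ring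
  -- Step 5: the prime window `Σ_{p ∈ P} 1/p ≤ 3η`
  have hwin : ∑ p ∈ P, (1 : ℝ) / p ≤ 3 * η := by
    have hsub : P ⊆ (Nat.primesLE (L * x)).filter (fun p : ℕ => W < (p : ℝ)) := by
      intro p hp
      rw [hP, Finset.mem_filter, Finset.mem_Icc] at hp
      rw [Finset.mem_filter, Nat.mem_primesLE]
      exact ⟨⟨hp.1.2.trans hML, hp.2.1⟩, hp.2.2⟩
    have hlogW : Real.log W = (1 - η) * Real.log x := by rw [hWdef, Real.log_rpow hxpos]
    have hL0 : (0 : ℝ) < L := by exact_mod_cast hL1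
    have hLx : Real.log ((L * x : ℕ) : ℝ) = Real.log L + Real.log x := by
      push_cast
      exact Real.log_mul hL0.ne' hxpos.ne'
    have hlogL : 0 ≤ Real.log L := Real.log_natCast_nonneg L
    have h1η : (1 : ℝ) / 2 ≤ 1 - η := by linarith
    have hlogW0 : 0 < Real.log W := by
      rw [hlogW]
      exact mul_pos (by linarith) hlogx0
    have hratio : Real.log (Real.log ((L * x : ℕ) : ℝ) / Real.log W) ≤ 2 * Real.log L / Real.log x + 2 * η := by
      have hpos : 0 < Real.log ((L * x : ℕ) : ℝ) / Real.log W := by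
        rw [hLx]
        positivity
      calc Real.log (Real.log ((L * x : ℕ) : ℝ) / Real.log W)
          ≤ Real.log ((L * x : ℕ) : ℝ) / Real.log W - 1 := Real.log_le_sub_one_of_pos hpos
        _ = (Real.log L + η * Real.log x) / ((1 - η) * Real.log x) := by
            rw [hLx, hlogW]
            field_simp
            ring
        _ ≤ (Real.log L + η * Real.log x) / ((1 / 2) * Real.log x) :=
            div_le_div_of_nonneg_left (by positivity) (by positivity)
              (mul_le_mul_of_nonneg_right h1η hlogx0.le)
        _ = 2 * Real.log L / Real.log x + 2 * η := by
            field_simp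
    have hKterm : 2 * K / Real.log W ≤ 4 * K / Real.log x := by
      rw [hlogW, div_le_div_iff₀ (mul_pos (by linarith) hlogx0) hlogx0]
      have hKl : 0 ≤ K * Real.log x := mul_nonneg hK0 hlogx0.le
      have := mul_le_mul_of_nonneg_left h1η hKl
      nlinarith
    have hsmall : 2 * Real.log L / Real.log x + 4 * K / Real.log x ≤ η := by
      rw [← add_div, div_le_iff₀ hlogx0]
      rw [div_le_iff₀ hη0] at hlogx
      linarith
    calc ∑ p ∈ P, (1 : ℝ) / p ≤ ∑ p ∈ (Nat.primesLE (L * x)).filter (fun p : ℕ => W < (p : ℝ)), (1 : ℝ) / p :=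
          Finset.sum_le_sum_of_subset_of_nonneg hsub fun p _ _ => by positivity
      _ ≤ Real.log (Real.log ((L * x : ℕ) : ℝ) / Real.log W) + 2 * K / Real.log W := hK W (L * x) hW2 hWN
      _ ≤ 3 * η := by linarith
  -- assembly
  have hΦ := hc x M hx2 hML
  have hΦ0 : 0 ≤ (x : ℝ) * Real.log x ^ (y - 1) := by
    have : 0 ≤ Real.log x ^ (y - 1) := Real.rpow_nonneg hlogx0.le _
    positivity
  have hMΦ0 : 0 ≤ (M : ℝ) * Real.log M ^ (y - 1) := by
    have : 0 ≤ Real.log M ^ (y - 1) := Real.rpow_nonneg (Real.log_natCast_nonneg M) _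
    positivity
  calc ∑ n ∈ (Icc 1 x).filter (fun n : ℕ => ∃ i, ∃ p ∈ (val f i n).primeFactors,
          (x : ℝ) ^ (((f i).natDegree : ℝ) - η) < (p : ℝ)), y ^ stat f n
      = ∑ n ∈ (Icc 1 x).filter (fun n : ℕ => ∃ i, ∃ p ∈ (val f i n).primeFactors,
          (x : ℝ) ^ (((f i).natDegree : ℝ) - η) < (p : ℝ)), g (a * n + b).toNat :=
        Finset.sum_congr rfl fun n hn => (hcls n hn).2
    _ ≤ ∑ m ∈ Icc 1 M, g m :=
        sum_toNat_le_sum_Icc ha (fun n hn => (Finset.mem_Icc.mp (Finset.mem_filter.mp hn).1).2)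
          (fun n hn => (hcls n hn).1) hg0
    _ ≤ ∑ m ∈ Icc 1 M, ∑ p ∈ P, (if p ∣ m then y ^ cardFactors m else 0) := Finset.sum_le_sum hstep2
    _ = ∑ p ∈ P, ∑ m ∈ Icc 1 M, (if p ∣ m then y ^ cardFactors m else 0) := Finset.sum_comm
    _ ≤ ∑ p ∈ P, y * C₁ * ((M : ℝ) / p * Real.log M ^ (y - 1)) := Finset.sum_le_sum hinner
    _ = y * C₁ * ((M : ℝ) * Real.log M ^ (y - 1)) * ∑ p ∈ P, (1 : ℝ) / p := by
        rw [Finset.mul_sum]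
        exact Finset.sum_congr rfl fun p _ => by ring
    _ ≤ y * C₁ * (c * ((x : ℝ) * Real.log x ^ (y - 1))) * (3 * η) :=
        mul_le_mul (mul_le_mul_of_nonneg_left hΦ (by positivity)) hwin
          (Finset.sum_nonneg fun p _ => by positivity) (by positivity)
    _ = (3 * y * C₁ * c) * η * ((x : ℝ) * Real.log x ^ (y - 1)) := by ring
    _ ≤ D * η * ((x : ℝ) * Real.log x ^ (y - 1)) := by
        gcongr
        linarith
    _ ≤ ε * ((x : ℝ) * Real.log x ^ (((1 : ℕ) : ℝ) * (y - 1))) := by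
        rw [Nat.cast_one, one_mul]
        exact mul_le_mul_of_nonneg_right hηD hΦ0

/-- **tails_linear_single** (registered helper of `stub_tails`, line `product-anatomy-subcritical`): ALL FOUR
tail clauses of `stub_tails` for a Bateman–Horn system of ONE LINEAR FORM, `1 ≤ y < 2`, unconditionally
(no Nair–Tenenbaum, no p-adic Roth: `p^ν ∣ an + b` forces `p^ν ≤ ax + b`). [folklore] -/
theorem tails_linear_single : ∀ (f : Fin 1 → ℤ[X]), IsBatemanHornSystem f → (f 0).natDegree = 1 →
    ∀ y : ℝ, 1 ≤ y → y < 2 → APrioriBound 1 f y ∧ RankinTail 1 f y ∧ TopClassBound 1 f y ∧ BalancedClassBound 1 f y := by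
  intro f hf h1 y hy hy2
  obtain ⟨a, b, ha, heval⟩ := exists_eval_eq_linear hf h1
  exact ⟨aPrioriBound_linear ha heval hy hy2, rankinTail_linear ha heval hy hy2,
    topClassBound_linear ha heval h1 hy hy2, balancedClassBound_linear ha heval y⟩

end Linear

/-! ### The empty system -/

/-- **tails_empty** (registered helper of `stub_tails`, line `product-anatomy-subcritical`): for `k = 0`
(`Ω_∅ ≡ 0`, every class empty) the four tail clauses hold for every `y` (`Σ_{n ≤ x} 1 = x + 1 ≤ 2x`). [folklore] -/
theorem tails_empty : ∀ (f : Fin 0 → ℤ[X]) (y : ℝ),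
    APrioriBound 0 f y ∧ RankinTail 0 f y ∧ TopClassBound 0 f y ∧ BalancedClassBound 0 f y := by
  intro f y
  have hstat : ∀ n, stat f n = 0 := fun n => by simp [stat]
  have hrhs : ∀ (ε : ℝ) (x : ℕ), 0 ≤ ε → 0 ≤ ε * ((x : ℝ) * Real.log x ^ (((0 : ℕ) : ℝ) * (y - 1))) := by
    intro ε x hε
    rw [Nat.cast_zero, zero_mul, Real.rpow_zero, mul_one]
    positivity
  refine ⟨⟨2, fun x hx => ?_⟩, fun ε hε => ⟨1, one_pos, fun θ τ _ _ _ => ?_⟩, fun ε hε => ⟨1, one_pos, ?_⟩,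
    fun ε hε => ⟨1, one_pos, ?_⟩⟩
  · simp only [hstat, pow_zero, Finset.sum_const, Finset.card_range, nsmul_eq_mul, mul_one, Nat.cast_zero,
      zero_mul, Real.rpow_zero]
    push_cast
    have : (2 : ℝ) ≤ x := by exact_mod_cast hx
    linarith
  · refine Filter.Eventually.of_forall fun x => ?_
    rw [Finset.filter_false_of_mem fun n _ => by simp, Finset.sum_empty]
    exact hrhs ε x hε.le
  · refine Filter.Eventually.of_forall fun x => ?_
    rw [Finset.filter_false_of_mem fun n _ => by simp, Finset.sum_empty]
    exact hrhs ε x hε.le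
  · refine Filter.Eventually.of_forall fun x => ?_
    rw [Finset.filter_false_of_mem fun n _ => by simp [prodVal], Finset.sum_empty]
    exact hrhs ε x hε.le

/-! ### Total degree at most one -/

/-- **tails_of_sum_natDegree_le_one** (registered helper of `stub_tails`, line `product-anatomy-subcritical`):
`stub_tails` for every Bateman–Horn system of total degree `≤ 1` — these are the empty system and one linear
form (each member has degree `≥ 1`) —, all four clauses, unconditionally. [folklore] -/
theorem tails_of_sum_natDegree_le_one : ∀ (k : ℕ) (f : Fin k → ℤ[X]), IsBatemanHornSystem f →
    (∑ i, (f i).natDegree) ≤ 1 → ∀ y : ℝ, 1 ≤ y → y < 2 →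
      APrioriBound k f y ∧ RankinTail k f y ∧ TopClassBound k f y ∧ BalancedClassBound k f y := by
  intro k
  match k with
  | 0 =>
      intro f _ _ y _ _
      exact tails_empty f y
  | 1 =>
      intro f hf hdeg y hy hy2
      have h1 : (f 0).natDegree = 1 := by
        have := hf.natDegree_pos 0
        rw [Fin.sum_univ_one] at hdeg
        omega
      exact tails_linear_single f hf h1 y hy hy2
  | k + 2 =>
      intro f hf hdeg y _ _
      exfalso
      have h2 : 2 ≤ ∑ i, (f i).natDegree :=
        calc 2 ≤ ∑ _i : Fin (k + 2), 1 := by simp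
          _ ≤ ∑ i, (f i).natDegree := Finset.sum_le_sum fun i _ => hf.natDegree_pos i
      omega

end

end Summit.Parity.BatemanHorn.Cruxes.LSDRealSegment.ProductAnatomySubcritical
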